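import Summits.HodgeConjecture.HodgeConjecture.Theorems.Ring2WeilCoverageNormCriteria
import Summits.HodgeConjecture.HodgeConjecture.Theorems.Ring2WeilCoverageNormTableC
import HarnessLib

/-!
# Weil-type family coverage — the rows `W6.1.19 = (3, ℚ(i), a ≡ 19)` (`C₄ × A₁₉`) and `W6.3.34 = (3, ℚ(√-3), a ≡ 34)` (`C₆ × S₁₇`) reached by curves (ring2-b02, gen 62)

research route conditional on HC_CM; not a corollary; Q11.4-sentence-2 already refuted in dim ≥ 3.

Ring 2, WEIL-TYPE FAMILY-COVERAGE CENSUS (`HOME/WEIL-FAMILY-COVERAGE.md` `## b02 (g = 6)`, block b02.22 P.S. 2, owner ring2-b02).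
The census's `S_n`-factor engine (`symwin2` / `direct3`: cycle-type classes, THEOREM X, Chevalley–Weil, random admissibility with a
transitivity + primitivity + Jordan certificate, the direct Gram determinant on a complement of the puncture radical) and its
«degree rule» (LEMMA DG: in `C_k × S_n` the three-twist data carry the class `[n]` up to the carrier's primes) produce the first
curve-carried members of two further rows of the `g = 6` table:

* §1 `W6.1.19 = (3, ℚ(i), a ≡ 19)`, `T(19) = {2, 19}`: 8 888 rigid `(i, i, -1)`-type data of `C₄ × A₁₉ / S₁₉`, among them
  `(0; c2:2⁸1³, c1:4³2³1, c1:(12)(6)1)` in `C₄ × A₁₉` (genus 20274183401472001; `d = 18`): hidden factor a Weil-type sixfold with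
  `ℚ(i)`-multiplication, `ℚ(i)`-signature `(3,3)`, Gram determinant `g₇ = 5/2432 = 5/(2⁷·19)`; here `g₇ ≡ 19` and `-g₇ ≡ -19` modulo
  `Nm(ℚ(i)ˣ)` (`g₇⁻¹·19 = 46208/5 = (456/5)² + (152/5)²`) and `[-g₇]` is NOT the split class — via `SqrtNeg1.not_mem_19` of the cell's
  `Ring2WeilCoverageNormTable` (descent at the inert prime 19), from which the row statement `sixfold_sqrtNeg1_neg19_ne_split` is
  derived here (one line; the table has the `a = 7, 21, 33, 57, …` rows but not yet this one);
* §2 `W6.3.34 = (3, ℚ(√-3), a ≡ 34)`, `T(34) = {2, 17}`: 2 457 rigid three-twist data of `C₆ × S₁₇`, among them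
  `(0; c3:2⁸1, c1:6²3·2·1³…, c2:(10)·2²…)` = `(0; c3:22222222, c1:6632, c2:(10)22)` (genus 320118685286401; `d = 16`): signature `(3,3)`,
  Gram determinant `g₈ = 1/33048 = 1/(2³·3⁵·17)`; `g₈ ≡ 34`, `-g₈ ≡ -34` modulo `Nm(ℚ(√-3)ˣ)` (`g₈⁻¹·34 = 3·612²`) and `[-g₈]` is NOT
  the split class by the cell's ALREADY-LANDED `sixfold_sqrtNeg3_neg34_ne_split` (`Ring2WeilCoverageNormTableC`, not restated).

Signature, admissibility, generation, THEOREM X and the (P2)/(P3) identities of the direct engine (all asserted on these two data) are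
computations / structure theorems of the census, not kernel facts; nothing here is a statement about Hodge classes; `HC_CM` is used
nowhere.

References: [cite: vanGeemen1994HodgeAV, 4.14, 5.2 and (5.4.1)].
-/

noncomputable section

set_option linter.dupNamespace false

open Literature.AlgebraicGeometry.Motives
open Literature.AlgebraicGeometry.VanGeemen1994
open Summit.HodgeConjecture.HodgeConjecture.Ring2.Hypotheses
open Summit.HodgeConjecture.Ring2WeilNormDescent

namespace Summit.HodgeConjecture.HodgeConjecture.Ring2.WeilCoverage

/-! ### §1 `C₄ × A₁₉` on W6.1.19 = `(3, ℚ(i), a ≡ 19)` -/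

/-- Row W6.1.19: `[(-19 : ℚ)] ≠ splitDiscriminantClass 3 1` — the sixfold component `(3, ℚ(√-1), δ = [-19])` is NON-split (from the cell's `SqrtNeg1.not_mem_19`, descent at the inert prime 19).
research route conditional on HC_CM; not a corollary; Q11.4-sentence-2 already refuted in dim ≥ 3. [cite: vanGeemen1994HodgeAV, (5.4.1)] -/
theorem sixfold_sqrtNeg1_neg19_ne_split :
    (QuotientGroup.mk (Units.mk0 (-19 : ℚ) (by norm_num)) : weilNormResidueGroup 1) ≠ splitDiscriminantClass 3 1 :=
  mk_neg_ne_split_of_odd (by decide) _ SqrtNeg1.not_mem_19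

/-- **`(0; c2:2⁸1³, c1:4³2³1, c1:(12)(6)1)` in `C₄ × A₁₉` (genus 20274183401472001, (3,3) sixfold): the literal Gram determinant `g₇ = 5/2432` has class `[19]` in `ℚˣ/Nm(ℚ(i)ˣ)`: `g₇⁻¹·19 = 46208/5 = (456/5)² + (152/5)²`.**
research route conditional on HC_CM; not a corollary; Q11.4-sentence-2 already refuted in dim ≥ 3. [cite: vanGeemen1994HodgeAV, (5.4.1)] -/
theorem c4xA19_rigid_c2_2e8_c1_4e3_2e3_c1_12_6_mk_gram_eq_nineteen :
    (QuotientGroup.mk (Units.mk0 ((5 : ℚ) / 2432) (by norm_num)) : weilNormResidueGroup 1) =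
      QuotientGroup.mk (Units.mk0 (19 : ℚ) (by norm_num)) := by
  rw [QuotientGroup.eq]
  have e : (Units.mk0 ((5 : ℚ) / 2432) (by norm_num))⁻¹ * Units.mk0 (19 : ℚ) (by norm_num) =
      Units.mk0 ((46208 : ℚ) / 5) (by norm_num) := Units.ext (by norm_num)
  rw [e]
  exact mem_normUnitsSubgroup_of_sq_add_mul_sq _ ((456 : ℚ) / 5) ((152 : ℚ) / 5) (by norm_num)

/-- **… the `det H`-class: `-g₇ ≡ -19` modulo `Nm(ℚ(i)ˣ)`.**
research route conditional on HC_CM; not a corollary; Q11.4-sentence-2 already refuted in dim ≥ 3. [cite: vanGeemen1994HodgeAV, 5.2] -/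
theorem c4xA19_rigid_c2_2e8_c1_4e3_2e3_c1_12_6_mk_negGram_eq_negNineteen :
    (QuotientGroup.mk (Units.mk0 ((-5 : ℚ) / 2432) (by norm_num)) : weilNormResidueGroup 1) =
      QuotientGroup.mk (Units.mk0 (-19 : ℚ) (by norm_num)) := by
  rw [QuotientGroup.eq]
  have e : (Units.mk0 ((-5 : ℚ) / 2432) (by norm_num))⁻¹ * Units.mk0 (-19 : ℚ) (by norm_num) =
      Units.mk0 ((46208 : ℚ) / 5) (by norm_num) := Units.ext (by norm_num)
  rw [e]
  exact mem_normUnitsSubgroup_of_sq_add_mul_sq _ ((456 : ℚ) / 5) ((152 : ℚ) / 5) (by norm_num)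

/-- … hence `[-g₇]` is NOT the split class `[(-1)³]` of `(3, ℚ(i))`: the hidden factor lies on the NON-split row W6.1.19.
research route conditional on HC_CM; not a corollary; Q11.4-sentence-2 already refuted in dim ≥ 3. [cite: vanGeemen1994HodgeAV, (5.4.1)] -/
theorem c4xA19_rigid_c2_2e8_c1_4e3_2e3_c1_12_6_mk_negGram_ne_split :
    (QuotientGroup.mk (Units.mk0 ((-5 : ℚ) / 2432) (by norm_num)) : weilNormResidueGroup 1) ≠
      splitDiscriminantClass 3 1 := by
  rw [c4xA19_rigid_c2_2e8_c1_4e3_2e3_c1_12_6_mk_negGram_eq_negNineteen]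
  exact sixfold_sqrtNeg1_neg19_ne_split

/-! ### §2 `C₆ × S₁₇` on W6.3.34 = `(3, ℚ(√-3), a ≡ 34)` -/

/-- **`(0; c3:22222222, c1:6632, c2:(10)22)` in `C₆ × S₁₇` (genus 320118685286401, (3,3) sixfold): the literal Gram determinant `g₈ = 1/33048` has class `[34]` in `ℚˣ/Nm(ℚ(√-3)ˣ)`: `g₈⁻¹·34 = 1123632 = 3·612²`.**
research route conditional on HC_CM; not a corollary; Q11.4-sentence-2 already refuted in dim ≥ 3. [cite: vanGeemen1994HodgeAV, (5.4.1)] -/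
theorem c6xS17_rigid_c3_2e8_c1_6632_c2_10_22_mk_gram_eq_thirtyFour :
    (QuotientGroup.mk (Units.mk0 ((1 : ℚ) / 33048) (by norm_num)) : weilNormResidueGroup 3) =
      QuotientGroup.mk (Units.mk0 (34 : ℚ) (by norm_num)) := by
  rw [QuotientGroup.eq]
  have e : (Units.mk0 ((1 : ℚ) / 33048) (by norm_num))⁻¹ * Units.mk0 (34 : ℚ) (by norm_num) =
      Units.mk0 (1123632 : ℚ) (by norm_num) := Units.ext (by norm_num)
  rw [e]
  exact mem_normUnitsSubgroup_of_sq_add_mul_sq _ (0 : ℚ) (612 : ℚ) (by norm_num)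

/-- **… the `det H`-class: `-g₈ ≡ -34` modulo `Nm(ℚ(√-3)ˣ)`.**
research route conditional on HC_CM; not a corollary; Q11.4-sentence-2 already refuted in dim ≥ 3. [cite: vanGeemen1994HodgeAV, 5.2] -/
theorem c6xS17_rigid_c3_2e8_c1_6632_c2_10_22_mk_negGram_eq_negThirtyFour :
    (QuotientGroup.mk (Units.mk0 ((-1 : ℚ) / 33048) (by norm_num)) : weilNormResidueGroup 3) =
      QuotientGroup.mk (Units.mk0 (-34 : ℚ) (by norm_num)) := by
  rw [QuotientGroup.eq]
  have e : (Units.mk0 ((-1 : ℚ) / 33048) (by norm_num))⁻¹ * Units.mk0 (-34 : ℚ) (by norm_num) =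
      Units.mk0 (1123632 : ℚ) (by norm_num) := Units.ext (by norm_num)
  rw [e]
  exact mem_normUnitsSubgroup_of_sq_add_mul_sq _ (0 : ℚ) (612 : ℚ) (by norm_num)

/-- … hence `[-g₈]` is NOT the split class of `(3, ℚ(√-3))`: the hidden factor lies on the NON-split row W6.3.34 (the cell's `sixfold_sqrtNeg3_neg34_ne_split`, `Ring2WeilCoverageNormTableC`).
research route conditional on HC_CM; not a corollary; Q11.4-sentence-2 already refuted in dim ≥ 3. [cite: vanGeemen1994HodgeAV, (5.4.1)] -/
theorem c6xS17_rigid_c3_2e8_c1_6632_c2_10_22_mk_negGram_ne_split :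
    (QuotientGroup.mk (Units.mk0 ((-1 : ℚ) / 33048) (by norm_num)) : weilNormResidueGroup 3) ≠
      splitDiscriminantClass 3 3 := by
  rw [c6xS17_rigid_c3_2e8_c1_6632_c2_10_22_mk_negGram_eq_negThirtyFour]
  exact sixfold_sqrtNeg3_neg34_ne_split

end Summit.HodgeConjecture.HodgeConjecture.Ring2.WeilCoverage

end
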